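import Summits.QuantumFields.QCD.Theorems.WilsonMobilityGapMobilityGapSketchReduction
import Summits.QuantumFields.QCD.Theses.PauliWegnerSea

/-!
# Crux `MobilityGap` (stmt-QuantumFields-9150) — line `Sketch`, stub `stub_lightMoment`:
exponent transfer, rate bookkeeping and the DEDUPLICATION of the infrared input across the QCD routes

Helper file (`--supports stmt-QuantumFields-9150`) of stub `stub_lightMoment` = `LawLightMoment`
(`…SketchDefs.lean` §5–§6): the light ½-moment input at the PINNED data `a_k = e^{-(k+1)}`,
`β_k = afBeta N_f 1 a_k`.  The stub itself is an open infrared law (existence of the Wilson chiral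
critical point of the interacting phase-quenched measure at `β_k`); this file records, kernel-checked,
how it sits among the existing items:

* §1 `LightMomentAt a β s` — the light-moment input with the data `(a, β)` and the exponent `s` free;
  `LightMoment Nf` is `LightMomentAt Nf aSeq (betaSeq Nf) (1/2)` (`lightMoment_iff`, `Iff.rfl`).
* §2 LYAPUNOV: lower bounds transfer UP in the exponent — `fm … s ^ (t/s) ≤ fm … t` for
  `0 < s ≤ t ≤ 1` (Jensen under the phase-quenched probability measure, `fm_rpow_le_fm`), hence
  `LightMomentAt a β s → LightMomentAt a β t` (`c ↦ c^{t/s}`, `r ↦ r t/s`) and the brief's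
  `lightMoment_of_lightMoment_rpow` (`s ∈ (0, ½]` in place of `½` implies `LightMoment`).
* §3 RATE BOOKKEEPING: the polynomial prefactor `(n+1)^{-p}` of the crux's clause (iii) is absorbed into a
  `k`-dependent amplitude at the cost of one unit of physical rate
  (`c' e^{-(C₁+1) a n} ≤ e^{-(C₁ a n + p log(n+1))}`, `c' = min(1, a/p)^p`).
* §4 FREE CURRENCY: `LightMomentFree Nf` — SOME admissible data (`a_k > 0`, `a_k → 0`, two-loop
  asymptotic scaling of `β_k` for some `Λ > 0`) and SOME exponent `s ∈ (0,1)` carry a light moment.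
  It is implied, by pure logic, by clauses (i)+(iii) of ANY witness of the crux at one degenerate tuple
  (`lightMomentFree_of_clauseI_lower`), hence by `WilsonMobilityGap.MobilityGap` itself
  (stmt-9150) and by the sibling crux `PauliWegnerSea.OneScaleTrajectory` (stmt-11513, clause (iii)
  verbatim) — and of course by `LawLightMoment` (pinned ⇒ free).  The PINNED law is implied by none of
  them: the only obstructions are the pinning of `(a_k, β_k)` and the exponent (`s ≤ ½` transfers to `½`,
  `s > ½` does not).  No other QCD route item carries a lower bound on the phase-quenched propagator
  moment (survey in the seat's `stub_lightMoment-DEDUP.md`).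
-/

noncomputable section

namespace Summit.QuantumFields.QCD.Theorems.MobilityGapSketch

open scoped BigOperators Topology
open MeasureTheory Filter Set
open Literature.MathematicalPhysics.QuantumFieldTheory Literature.MathematicalPhysics.QuantumLattice
  Literature.Probability.LatticeModels

/-! ### §1 The light-moment input with free data and exponent -/

/-- `LightMomentAt Nf a β s`: the light input in `s`-MOMENT currency along the data `(a, β)` — there is a
physical rate `r` such that, eventually in `k`, at SOME bare mass `x > -1` (degenerate tuple) some
flavour's phase-quenched `s`-th moment of the propagator entry sum obeys
`c · e^{-r a_k n} ≤ E_{|w|,β_k,S,x}[(Σ|G_f(0, n e₀)|)^s]` for all tori `S ≥ S₀` and all `n ≤ S`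
(`c > 0` and `S₀` may depend on `k`; only `r` is `k`-uniform). -/
def LightMomentAt (Nf : ℕ) (a β : ℕ → ℝ) (s : ℝ) : Prop :=
  ∃ r : ℝ, ∀ᶠ k in atTop, ∃ x : ℝ, -1 < x ∧ ∃ (f : Fin Nf) (c : ℝ), 0 < c ∧ ∃ S₀ : ℕ,
    ∀ S : ℕ, S₀ ≤ S → ∀ n : ℕ, n ≤ S →
      c * Real.exp (-(r * (a k * n))) ≤ fm Nf (β k) (fun _ => x) S f (Pi.single 0 (n : ℤ)) s

/-- `LightMoment Nf` IS `LightMomentAt` at the line's pinned data `(aSeq, betaSeq Nf)` and exponent `½`. -/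
theorem lightMoment_iff (Nf : ℕ) : LightMoment Nf ↔ LightMomentAt Nf aSeq (betaSeq Nf) (1 / 2) :=
  Iff.rfl

/-! ### §2 Lyapunov: lower bounds transfer up in the exponent -/

/-- `fm` is the phase-quenched expectation `⟨X^s⟩₊` of the `s`-th power of the entry sum. -/
theorem fm_eq_expect (Nf : ℕ) (β : ℝ) (t : Fin Nf → ℝ) (S : ℕ) (f : Fin Nf)
    (v : Literature.Probability.LatticeModels.Site 4) (s : ℝ) :
    fm Nf β t S f v s = qcdPhaseQuenchedExpect β (2 * S + 1) t (fun U => propSum Nf S t f v U ^ s) := by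
  rw [qcdPhaseQuenchedExpect_eq_div]
  rfl

/-- **Lyapunov's inequality for the phase-quenched moments** (Jensen for the convex `y ↦ y^q`, `q ≥ 1`,
under the probability measure `qcdLatticeMeasure`): `⟨X^s⟩₊^q ≤ ⟨X^{sq}⟩₊` for `0 ≤ s`, `1 ≤ q`,
`s q ≤ 1` (the last condition only to stay inside the landed integrability range `X^u`, `u ≤ 1`). -/
theorem fm_rpow_le_fm_mul (Nf : ℕ) (β : ℝ) (t : Fin Nf → ℝ) (S : ℕ) (f : Fin Nf)
    (v : Literature.Probability.LatticeModels.Site 4) {s q : ℝ} (hs0 : 0 ≤ s) (hq : 1 ≤ q)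
    (hsq : s * q ≤ 1) : fm Nf β t S f v s ^ q ≤ fm Nf β t S f v (s * q) := by
  have hs1 : s ≤ 1 := by nlinarith
  have hq0 : 0 ≤ q := by linarith
  rw [fm_eq_expect, fm_eq_expect]
  have hcomp : ((fun y : ℝ => y ^ q) ∘ fun U : GaugeConfig 4 (2 * S + 1) SU3 => propSum Nf S t f v U ^ s) =
      fun U => propSum Nf S t f v U ^ (s * q) := by
    funext U
    simp only [Function.comp]
    rw [← Real.rpow_mul (propSum_nonneg Nf S t f v U)]
  have hJ := qcdPhaseQuenchedExpect_jensen_all (S := 2 * S + 1) β t (convexOn_rpow hq)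
    (Real.continuous_rpow_const hq0).continuousOn isClosed_Ici
    (fun U => propSum Nf S t f v U ^ s)
    (Eventually.of_forall fun U => Real.rpow_nonneg (propSum_nonneg Nf S t f v U) _)
    (integrable_propSum_rpow Nf S β t f v hs0 hs1)
    (by rw [hcomp]; exact integrable_propSum_rpow Nf S β t f v (by positivity) hsq)
  rw [hcomp] at hJ
  exact hJ

/-- Lyapunov, exponent form: `⟨X^s⟩₊^{t/s} ≤ ⟨X^t⟩₊` for `0 < s ≤ t ≤ 1`. -/
theorem fm_rpow_le_fm (Nf : ℕ) (β : ℝ) (tup : Fin Nf → ℝ) (S : ℕ) (f : Fin Nf)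
    (v : Literature.Probability.LatticeModels.Site 4) {s t : ℝ} (hs : 0 < s) (hst : s ≤ t) (ht : t ≤ 1) :
    fm Nf β tup S f v s ^ (t / s) ≤ fm Nf β tup S f v t := by
  have h := fm_rpow_le_fm_mul Nf β tup S f v (s := s) (q := t / s) hs.le
    (by rwa [le_div_iff₀ hs, one_mul]) (by rwa [mul_div_cancel₀ _ hs.ne'])
  rwa [mul_div_cancel₀ _ hs.ne'] at h

/-- **Exponent transfer for the light input**: a light `s`-moment is a light `t`-moment for every
`t ∈ [s, 1]` (amplitude `c ↦ c^{t/s}`, rate `r ↦ r t/s`; data `(a, β)` arbitrary). -/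
theorem lightMomentAt_mono {Nf : ℕ} {a β : ℕ → ℝ} {s t : ℝ} (hs : 0 < s) (hst : s ≤ t) (ht : t ≤ 1)
    (h : LightMomentAt Nf a β s) : LightMomentAt Nf a β t := by
  obtain ⟨r, hk⟩ := h
  refine ⟨r * (t / s), hk.mono fun k hkk => ?_⟩
  obtain ⟨x, hx, f, c, hc, S₀, hS⟩ := hkk
  refine ⟨x, hx, f, c ^ (t / s), Real.rpow_pos_of_pos hc _, S₀, fun S hSS n hn => ?_⟩
  have hq0 : 0 ≤ t / s := div_nonneg (hs.le.trans hst) hs.le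
  have hlow := hS S hSS n hn
  have h1 : (c * Real.exp (-(r * (a k * n)))) ^ (t / s) ≤ fm Nf (β k) (fun _ => x) S f (Pi.single 0 (n : ℤ)) s ^ (t / s) :=
    Real.rpow_le_rpow (mul_nonneg hc.le (Real.exp_pos _).le) hlow hq0
  have hval : (c * Real.exp (-(r * (a k * n)))) ^ (t / s) =
      c ^ (t / s) * Real.exp (-(r * (t / s) * (a k * n))) := by
    rw [Real.mul_rpow hc.le (Real.exp_pos _).le, ← Real.exp_mul]
    congr 2
    ring
  rw [← hval]
  exact h1.trans (fm_rpow_le_fm Nf (β k) (fun _ => x) S f _ hs hst ht)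

/-- **`lightMoment_of_lightMoment_rpow`** (registered helper sub-goal of `stub_lightMoment`): the
light input at ANY exponent `s ∈ (0, ½]` along the line's data `(aSeq, betaSeq N_f)` implies
`LightMoment N_f` (exponent `½`) — Lyapunov under the phase-quenched probability measure. -/
theorem lightMoment_of_lightMoment_rpow :
    ∀ (Nf : ℕ) (s : ℝ), 0 < s → s ≤ 1 / 2 → LightMomentAt Nf aSeq (betaSeq Nf) s → LightMoment Nf :=
  fun Nf _ hs hs2 h => (lightMoment_iff Nf).2 (lightMomentAt_mono hs hs2 (by norm_num) h)

/-- Law level: a light `s`-moment law for `N_f ∈ {2,3}` with `s ∈ (0, ½]` implies `LawLightMoment`. -/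
theorem lawLightMoment_of_rpow {s : ℝ} (hs : 0 < s) (hs2 : s ≤ 1 / 2)
    (h : ∀ Nf : ℕ, Nf = 2 ∨ Nf = 3 → LightMomentAt Nf aSeq (betaSeq Nf) s) : LawLightMoment :=
  fun Nf hNf => lightMoment_of_lightMoment_rpow Nf s hs hs2 (h Nf hNf)

/-! ### §3 Rate bookkeeping: the polynomial prefactor costs one unit of physical rate -/

/-- **Absorbing `(n+1)^{-p}`.** For `a > 0` and any `C₁`, `p` there is `c' > 0` with
`c' e^{-(C₁+1) a n} ≤ e^{-(C₁ a n + p log(n+1))}` for all `n` (`c' = 1` if `p ≤ 0`, else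
`c' = ε^p` with `ε = min 1 (a/p)`, from `ε (n+1) ≤ e^{ε n}`).  So the crux's clause-(iii) shape
`c₀ e^{-(C₁ a_k n + p log(n+1))}` feeds the pure-exponential shape of `LightMomentAt` with rate `C₁ + 1`
and a `k`-dependent amplitude. -/
theorem exp_poly_absorb {a : ℝ} (ha : 0 < a) (C₁ p : ℝ) :
    ∃ c' : ℝ, 0 < c' ∧ ∀ n : ℕ,
      c' * Real.exp (-((C₁ + 1) * (a * n))) ≤ Real.exp (-(C₁ * (a * n) + p * Real.log (n + 1))) := by
  rcases le_or_gt p 0 with hp | hp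
  · refine ⟨1, one_pos, fun n => ?_⟩
    rw [one_mul, Real.exp_le_exp]
    have hlog : 0 ≤ Real.log ((n : ℝ) + 1) := Real.log_nonneg (by simp)
    have hn : 0 ≤ a * n := by positivity
    nlinarith
  · set ε : ℝ := min 1 (a / p) with hε
    have hε0 : 0 < ε := lt_min one_pos (div_pos ha hp)
    have hε1 : ε ≤ 1 := min_le_left _ _
    have hεp : p * ε ≤ a := by
      have : ε ≤ a / p := min_le_right _ _
      rwa [le_div_iff₀ hp, mul_comm] at this
    refine ⟨ε ^ p, Real.rpow_pos_of_pos hε0 _, fun n => ?_⟩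
    have hn0 : (0 : ℝ) ≤ n := Nat.cast_nonneg _
    have hn1 : (0 : ℝ) < n + 1 := by positivity
    -- `log (ε (n+1)) ≤ ε n`
    have hkey : Real.log (ε * ((n : ℝ) + 1)) ≤ ε * n := by
      rw [Real.log_le_iff_le_exp (by positivity)]
      have := Real.add_one_le_exp (ε * n)
      nlinarith
    rw [Real.rpow_def_of_pos hε0, ← Real.exp_add, Real.exp_le_exp, Real.log_mul hε0.ne' hn1.ne'] at *
    nlinarith [mul_le_mul_of_nonneg_left hkey hp.le, mul_le_mul_of_nonneg_right hεp hn0]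

/-! ### §4 Free currency and the deduplication theorems -/

/-- **`LightMomentFree Nf`** — the light input in FREE currency (the weakest reformulation of
`stub_lightMoment` implied by the existing items): SOME admissible data — spacings `a_k > 0`,
`a_k → 0`, inverse couplings `β_k` on the two-loop profile for SOME `Λ > 0`
(`β_k - afBeta N_f Λ a_k → 0`, the body of `QCDScheme.HasAsymptoticScaling`) — and SOME exponent
`s ∈ (0,1)` carry a light `s`-moment `LightMomentAt Nf a β s`. -/
def LightMomentFree (Nf : ℕ) : Prop :=
  ∃ a β : ℕ → ℝ, (∀ k, 0 < a k) ∧ Tendsto a atTop (𝓝 0) ∧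
    (∃ Λ > (0 : ℝ), Tendsto (fun k => β k - afBeta Nf Λ (a k)) atTop (𝓝 0)) ∧
      ∃ s : ℝ, 0 < s ∧ s < 1 ∧ LightMomentAt Nf a β s

/-- Pinned ⇒ free: the line's `LightMoment` is a `LightMomentFree` (data `(aSeq, betaSeq)`, `Λ = 1`,
`s = ½`). -/
theorem lightMomentFree_of_lightMoment {Nf : ℕ} (h : LightMoment Nf) : LightMomentFree Nf :=
  ⟨aSeq, betaSeq Nf, aSeq_pos, tendsto_aSeq,
    ⟨1, one_pos, tendsto_const_nhds.congr' (Eventually.of_forall fun k => by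
      show (0 : ℝ) = betaSeq Nf k - afBeta Nf 1 (aSeq k); rw [betaSeq, sub_self])⟩,
    1 / 2, by norm_num, by norm_num, (lightMoment_iff Nf).1 h⟩

/-- `LawLightMoment` ⇒ the free law. -/
theorem lightMomentFree_of_lawLightMoment (h : LawLightMoment) :
    ∀ Nf : ℕ, Nf = 2 ∨ Nf = 3 → LightMomentFree Nf :=
  fun Nf hNf => lightMomentFree_of_lightMoment (h Nf hNf)

/-- The disprover's verbatim `fm` (`MobilityGapNegative.fm`, `Negative/LowerPin.lean`) is the line's `fm`. -/
theorem negativeFm_eq_fm : @MobilityGapNegative.fm = @fm := rfl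

/-- **The infrared content of clauses (i)+(iii) at ONE degenerate tuple is a free light moment.**
For any regularisation with two-loop asymptotic scaling and any `μ`, clause (i) and clause (iii) LOWER
of the crux for the degenerate tuple `m ≡ μ` (`MobilityGapNegative.ClauseI`, `.Lower`, verbatim
abbreviations) give `LightMomentFree`: data `(reg.a, reg.β)`, exponent the `s` of (iii), rate `C₁ + 1`
(`exp_poly_absorb`), `x_k = m_crit(k) + a_k μ / Z_m(k)`, `S₀ = L_k`. -/
theorem lightMomentFree_of_clauseI_lower {Nf : ℕ} (hNf : 0 < Nf) (reg : QCDRegularisation Nf)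
    (hAS : (reg.scheme 0 0 0).HasAsymptoticScaling) (μ : ℝ)
    (hI : MobilityGapNegative.ClauseI reg (fun _ => μ)) (hL : MobilityGapNegative.Lower reg (fun _ => μ)) :
    LightMomentFree Nf := by
  obtain ⟨s, c₀, C₁, p, hs, hs1, hc₀, hev⟩ := hL
  refine ⟨reg.a, reg.β, reg.a_pos, reg.tendsto_a, hAS, s, hs, hs1, C₁ + 1, ?_⟩
  filter_upwards [hev, hI ⟨0, hNf⟩] with k hk hxk
  obtain ⟨c', hc', hcn⟩ := exp_poly_absorb (reg.a_pos k) C₁ p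
  refine ⟨reg.mcrit k + reg.a k * μ / reg.Zm k, hxk, ⟨0, hNf⟩, c₀ * c', mul_pos hc₀ hc', reg.L k,
    fun S hS n hn => ?_⟩
  have h1 := hk S hS ⟨0, hNf⟩ n hn
  rw [negativeFm_eq_fm] at h1
  calc c₀ * c' * Real.exp (-((C₁ + 1) * (reg.a k * n)))
      = c₀ * (c' * Real.exp (-((C₁ + 1) * (reg.a k * n)))) := by ring
    _ ≤ c₀ * Real.exp (-(C₁ * (reg.a k * n) + p * Real.log (n + 1))) :=
        mul_le_mul_of_nonneg_left (hcn n) hc₀.le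
    _ ≤ _ := h1

/-- **Dedup 1: the crux itself carries the free law.** Every witness of `MobilityGap`
(stmt-QuantumFields-9150) yields `LightMomentFree` for `N_f ∈ {2,3}` (clauses (i)+(iii) at `m ≡ 1`). -/
theorem lightMomentFree_of_mobilityGap (h : Summit.QuantumFields.QCD.Theses.WilsonMobilityGap.MobilityGap) :
    ∀ Nf : ℕ, Nf = 2 ∨ Nf = 3 → LightMomentFree Nf := by
  intro Nf hNf
  have hNf0 : 0 < Nf := by rcases hNf with rfl | rfl <;> norm_num
  obtain ⟨reg, -, hAS, hm⟩ := MobilityGapNegative.mobilityGap_iff.1 h Nf hNf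
  obtain ⟨hI, -, hL, -⟩ := hm (fun _ => 1) (fun _ => one_pos)
  exact lightMomentFree_of_clauseI_lower hNf0 reg hAS 1 hI hL

/-- **Dedup 2: the sibling crux `OneScaleTrajectory` (stmt-QuantumFields-11513, route `PauliWegnerSea`)
carries the free law** — its clauses (i) and (iii) are verbatim the crux's, along its own `∃ reg`. -/
theorem lightMomentFree_of_oneScaleTrajectory
    (h : Summit.QuantumFields.QCD.Theses.PauliWegnerSea.OneScaleTrajectory) :
    ∀ Nf : ℕ, Nf = 2 ∨ Nf = 3 → LightMomentFree Nf := by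
  intro Nf hNf
  have hNf0 : 0 < Nf := by rcases hNf with rfl | rfl <;> norm_num
  obtain ⟨reg, -, hAS, hm⟩ := h Nf hNf
  obtain ⟨hI, -, hL, -⟩ := hm (fun _ => 1) (fun _ => one_pos)
  exact lightMomentFree_of_clauseI_lower hNf0 reg hAS 1 hI hL

end Summit.QuantumFields.QCD.Theorems.MobilityGapSketch

end
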